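import Literature.Computability.AlgebraicComplexity.InterfaceMatMulTerms
import Literature.Computability.AlgebraicComplexity.InterfaceSlotSymmetry
import Literature.Barriers.MatrixMultiplication.UniversalMethodBarrierProducts
import HarnessLib

/-!
# Interface tensors all of whose terms are matrix multiplication terms (Vassilevska Williams–Xu–Xu–Zhou
2024, Thm. 6.1 for whole parameter lists, and step 3 of the Procedure of Degeneration, §8) — proved

Topic `Literature/Computability/AlgebraicComplexity`.  Theorem 6.1 of Vassilevska Williams–Xu–Xu–Zhou,
*New bounds for matrix multiplication: from alpha to omega* (SODA 2024, arXiv:2307.07970): "If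
`k_t = 0`, then `T_{i_t,j_t,k_t}^{⊗n_t}[β_X, β_Y, β_Z, ε] ≡ ⟨1, M, 1⟩ … Similar results hold when
`i_t = 0` or `j_t = 0`", used in §6 ("let us handle the terms `t ∈ [s]` … where `i_t = 0`, `j_t = 0`
or `k_t = 0`, which are already matrix multiplication tensors") and in §8's Procedure of Degeneration,
step 3: "The level-1 `3ε`-interface tensor `𝒯^{(1)}` can degenerate into a matrix multiplication tensor
`⟨a₁, b₁, c₁⟩` according to Thm. 6.1" (at level 1 every constituent tensor `T_{i,j,k}`, `i+j+k = 2`,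
has a zero index).  `InterfaceMatMulTerms.lean` proves Thm. 6.1 for ONE term (`cwSplitTerm`); this
file proves it for whole interface tensors `𝒯_{τ,L,ε}` (Def. 4.1) and assembles the three
orientations into one matrix multiplication tensor:

* `mmVars`, `interfaceTensor_apply_of_k_eq_zero`, `vxxz2024_thm61_iso_multi` — **if every term has
  `k_t = 0`, `𝒯_{τ,L,ε} ≅ ⟨M, 1, 1⟩`** (restrictions both ways; `M = |mmVars|`, the `X`-variables
  whose partner `x̄` is an admissible `Y`-variable; the same proof as for one term: the unique
  `Z`-variable is `z₀ = 0`, and `x y z₀` is a term iff `y = x̄`);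
* `vxxz2024_thm61_iso_multi_i`, `vxxz2024_thm61_iso_multi_j` — the cases `i_t = 0` (`≅ ⟨1, M, 1⟩`) and
  `j_t = 0` (`≅ ⟨1, 1, M⟩`) by the slot symmetries of `InterfaceSlotSymmetry.lean`
  (`matMulTensor K k m n` has slots `(Z-forms k×n, X k×m, Y m×n)`; the three placements are the
  inner product with the trivial slot in `Z`, `X`, `Y` position respectively);
* `vxxz2024_thm61_matMul` — **the interface tensor whose parameter list is the concatenation of a
  `k = 0` list, an `i = 0` list and a `j = 0` list restricts to `⟨M₁, M₂, M₃⟩`** (Def. 4.1: the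
  concatenation is the tensor product; `⟨M₁,1,1⟩ ⊗ ⟨1,M₂,1⟩ ⊗ ⟨1,1,M₃⟩ ≥ ⟨M₁,M₂,M₃⟩`).

Everything is proved; the only definition is `mmVars`; no named facts.

## References

* V. Vassilevska Williams, Y. Xu, Z. Xu, R. Zhou, *New bounds for matrix multiplication: from alpha
  to omega*, SODA 2024, arXiv:2307.07970 (held: `paper:arxiv-2307.07970`), Thm. 6.1, §6 (first
  paragraphs), §8 (Procedure of Degeneration, steps 3–4). [VassilevskaWilliamsXuXuZhou2024]
-/

noncomputable section

open scoped BigOperators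
open Finset

namespace Literature.Computability.AlgebraicComplexity

open Literature.Barriers.MatrixMultiplication (bigCwTensor bigCwTensor_apply tensorRestrictsTo_kronecker_matMulTensor)

universe u

/-! ## Interface tensors with `k_t = 0` for every term -/

section KZero

variable {c n s : ℕ} (K : Type u) [CommSemiring K] (q : ℕ) (τ : Fin n → Fin s) (L : Fin s → InterfaceTerm c)

/-- **"There is only one `Z`-variable `z₀`"**: if every term has `k_t = 0`, an admissible
`Z`-variable has all indices at level `0`. [cite: VassilevskaWilliamsXuXuZhou2024, Thm. 6.1 (proof)] -/
theorem eq_zero_of_mem_levelBlocksZ_of_k_eq_zero (hk : ∀ t, (L t).k = 0) {ε : ℝ}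
    {z : Fin n → Fin c → Fin (q + 2)} (hz : levelSeq z ∈ levelBlocksZ τ L ε) : z = 0 := by
  have h := (mem_admissibleSeqs.1 hz).1
  funext u p
  have hu := h u
  rw [hk, patternLevel_levelSeq] at hu
  have hp : cwLevel (z u p) = 0 := (sum_eq_zero_iff.1 hu) p (mem_univ _)
  exact (cwLevel_eq_zero_iff _).1 hp

/-- **An interface tensor with `k_t = 0` for all `t` is the graph of `x ↦ x̄` on its variables**:
`𝒯(x, y, z) = [x, y, z admissible] · [y = x̄]`. [cite: VassilevskaWilliamsXuXuZhou2024, Thm. 6.1 (proof)] -/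
theorem interfaceTensor_apply_of_k_eq_zero (hk : ∀ t, (L t).k = 0) (ε : ℝ) (x y z : Fin n → Fin c → Fin (q + 2)) :
    interfaceTensor K q τ L ε x y z =
      if (levelSeq x ∈ levelBlocksX τ L ε ∧ levelSeq y ∈ levelBlocksY τ L ε ∧ levelSeq z ∈ levelBlocksZ τ L ε) ∧
          y = cwDualSeq x then 1 else 0 := by
  rw [interfaceTensor_apply]
  by_cases hadm : levelSeq x ∈ levelBlocksX τ L ε ∧ levelSeq y ∈ levelBlocksY τ L ε ∧ levelSeq z ∈ levelBlocksZ τ L ε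
  · rw [if_pos hadm]
    have hz : z = 0 := eq_zero_of_mem_levelBlocksZ_of_k_eq_zero q τ L hk hadm.2.2
    have hz' : ∀ u p, z u p = 0 := fun u p => by rw [hz]; rfl
    by_cases hy : y = cwDualSeq x
    · rw [if_pos ⟨hadm, hy⟩]
      refine Finset.prod_eq_one fun u _ => Finset.prod_eq_one fun p _ => ?_
      rw [hz', hy, cwDualSeq_apply, bigCwTensor_zero_right, if_pos rfl]
    · rw [if_neg fun h => hy h.2]
      obtain ⟨u, hu⟩ := Function.ne_iff.1 hy
      obtain ⟨p, hp⟩ := Function.ne_iff.1 hu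
      refine Finset.prod_eq_zero (mem_univ u) (Finset.prod_eq_zero (mem_univ p) ?_)
      rw [hz', bigCwTensor_zero_right, if_neg]
      simpa using hp
  · rw [if_neg hadm, if_neg fun h => hadm h.1]

/-- **The `X`-variables of the matrix multiplication tensor** (`k = 0` orientation): admissible `x`
whose partner `x̄` is an admissible `Y`-variable — `M = |mmVars|`. [cite: VassilevskaWilliamsXuXuZhou2024, Thm. 6.1 (M)] -/
def mmVars (q : ℕ) (τ : Fin n → Fin s) (L : Fin s → InterfaceTerm c) (ε : ℝ) : Finset (Fin n → Fin c → Fin (q + 2)) :=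
  univ.filter fun x => levelSeq x ∈ levelBlocksX τ L ε ∧ levelSeq (cwDualSeq x) ∈ levelBlocksY τ L ε

/-- Membership in `mmVars`. [cite: VassilevskaWilliamsXuXuZhou2024, Thm. 6.1] -/
theorem mem_mmVars {ε : ℝ} {x : Fin n → Fin c → Fin (q + 2)} :
    x ∈ mmVars q τ L ε ↔ levelSeq x ∈ levelBlocksX τ L ε ∧ levelSeq (cwDualSeq x) ∈ levelBlocksY τ L ε := by
  simp [mmVars]

/-- Outside admissible `z₀` the tensor vanishes identically. [cite: VassilevskaWilliamsXuXuZhou2024, Thm. 6.1 (proof)] -/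
theorem interfaceTensor_eq_zero_of_zero_not_mem (hk : ∀ t, (L t).k = 0) (ε : ℝ)
    (hz : levelSeq (0 : Fin n → Fin c → Fin (q + 2)) ∉ levelBlocksZ τ L ε) : interfaceTensor K q τ L ε = 0 := by
  funext x y z
  rw [Pi.zero_apply, Pi.zero_apply, Pi.zero_apply, interfaceTensor_apply_of_k_eq_zero K q τ L hk ε, if_neg]
  rintro ⟨⟨-, -, h⟩, -⟩
  have := eq_zero_of_mem_levelBlocksZ_of_k_eq_zero q τ L hk h
  subst this
  exact hz h

/-- The support: a non-zero entry has `x ∈ mmVars`, `ȳ ∈ mmVars`, `z = z₀`. [cite: VassilevskaWilliamsXuXuZhou2024, Thm. 6.1 (proof)] -/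
theorem interfaceTensor_support_of_k_eq_zero (hk : ∀ t, (L t).k = 0) (ε : ℝ) {x y z : Fin n → Fin c → Fin (q + 2)}
    (h : interfaceTensor K q τ L ε x y z ≠ 0) : x ∈ mmVars q τ L ε ∧ cwDualSeq y ∈ mmVars q τ L ε ∧ z = 0 := by
  rw [interfaceTensor_apply_of_k_eq_zero K q τ L hk ε] at h
  by_cases hc : (levelSeq x ∈ levelBlocksX τ L ε ∧ levelSeq y ∈ levelBlocksY τ L ε ∧ levelSeq z ∈ levelBlocksZ τ L ε) ∧
      y = cwDualSeq x
  · obtain ⟨⟨hx, hy, hz⟩, rfl⟩ := hc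
    refine ⟨(mem_mmVars q τ L).2 ⟨hx, hy⟩, ?_, eq_zero_of_mem_levelBlocksZ_of_k_eq_zero q τ L hk hz⟩
    rw [cwDualSeq_cwDualSeq, mem_mmVars]
    exact ⟨hx, hy⟩
  · exact absurd (if_neg hc) h

/-- **VXXZ 2024, Theorem 6.1 for a whole interface tensor, `k`-orientation**: if every term of the
parameter list has `k_t = 0` and `z₀` is admissible, `𝒯_{τ,L,ε} ≥ ⟨M, 1, 1⟩` and `⟨M, 1, 1⟩ ≥ 𝒯_{τ,L,ε}`
(isomorphic up to zero padding), `M = |mmVars|` — the printed `⟨1, M, 1⟩`, placed with the trivial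
slot in `Z` position. [cite: VassilevskaWilliamsXuXuZhou2024, Thm. 6.1] -/
theorem vxxz2024_thm61_iso_multi (hk : ∀ t, (L t).k = 0) (ε : ℝ)
    (hz : levelSeq (0 : Fin n → Fin c → Fin (q + 2)) ∈ levelBlocksZ τ L ε) :
    TensorRestrictsTo (interfaceTensor K q τ L ε) (matMulTensor K (mmVars q τ L ε).card 1 1) ∧
      TensorRestrictsTo (matMulTensor K (mmVars q τ L ε).card 1 1) (interfaceTensor K q τ L ε) := by
  set V := mmVars q τ L ε with hV
  let e : ↥V ≃ Fin V.card := Fintype.equivFinOfCardEq (Fintype.card_coe V)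
  have hval : ∀ (x : ↥V) (y : Fin n → Fin c → Fin (q + 2)), cwDualSeq y ∈ V →
      interfaceTensor K q τ L ε x.1 y 0 = if y = cwDualSeq x.1 then 1 else 0 := by
    intro x y hy
    rw [interfaceTensor_apply_of_k_eq_zero K q τ L hk ε]
    have hx := (mem_mmVars q τ L).1 x.2
    have hy' := (mem_mmVars q τ L).1 hy
    rw [cwDualSeq_cwDualSeq] at hy'
    by_cases h : y = cwDualSeq x.1
    · subst h
      rw [if_pos ⟨⟨hx.1, hx.2, by simpa using hz⟩, rfl⟩, if_pos rfl]
    · rw [if_neg fun h' => h h'.2, if_neg h]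
  constructor
  · have key : matMulTensor K V.card 1 1 = fun a b _c =>
        interfaceTensor K q τ L ε (e.symm a.1).1 (cwDualSeq (e.symm b.1).1) 0 := by
      funext a b c'
      rw [hval (e.symm a.1) _ (by rw [cwDualSeq_cwDualSeq]; exact (e.symm b.1).2)]
      simp only [matMulTensor, cwDualSeq_injective.eq_iff]
      have h2 : b.2 = c'.1 := Subsingleton.elim _ _
      have h3 : a.2 = c'.2 := Subsingleton.elim _ _
      simp only [h2, h3, and_true]
      by_cases hab : a.1 = b.1
      · rw [if_pos hab, if_pos (by rw [hab])]
      · rw [if_neg hab, if_neg]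
        intro h
        exact hab (by
          have := congrArg e (Subtype.ext h).symm
          simpa using this)
    rw [key]
    exact TensorRestrictsTo.comap _ _ _ _
  · have hext : TensorRestrictsTo (fun (x : {x // x ∈ V}) (y : {y // cwDualSeq y ∈ V})
        (z : {z : Fin n → Fin c → Fin (q + 2) // z = 0}) => interfaceTensor K q τ L ε x.1 y.1 z.1)
        (interfaceTensor K q τ L ε) := by
      convert tensorRestrictsTo_extend_subtype (interfaceTensor K q τ L ε) (fun x => x ∈ V)
        (fun y => cwDualSeq y ∈ V) (fun z => z = 0)
        fun x y z h => interfaceTensor_support_of_k_eq_zero K q τ L hk ε h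
    have key : (fun (x : {x // x ∈ V}) (y : {y // cwDualSeq y ∈ V}) (z : {z : Fin n → Fin c → Fin (q + 2) // z = 0}) =>
        interfaceTensor K q τ L ε x.1 y.1 z.1) = fun x y _z =>
        matMulTensor K V.card 1 1 (e ⟨x.1, x.2⟩, 0) (e ⟨cwDualSeq y.1, y.2⟩, 0) (0, 0) := by
      funext x y z
      obtain ⟨z, rfl⟩ := z
      rw [hval ⟨x.1, x.2⟩ y.1 y.2]
      simp only [matMulTensor, and_true, EmbeddingLike.apply_eq_iff_eq, Subtype.mk.injEq]
      by_cases h : y.1 = cwDualSeq x.1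
      · rw [if_pos h, if_pos (by rw [h, cwDualSeq_cwDualSeq])]
      · rw [if_neg h, if_neg]
        intro h'
        exact h (by rw [h', cwDualSeq_cwDualSeq])
    rw [key] at hext
    exact (TensorRestrictsTo.comap _ _ _ _).trans hext

end KZero

/-! ## The orientations `i_t = 0` and `j_t = 0` -/

section Orient

variable {c n s : ℕ} (K : Type u) [CommSemiring K] (q : ℕ) (τ : Fin n → Fin s) (L : Fin s → InterfaceTerm c)

/-- `⟨M,1,1⟩` read with the first and third slots exchanged is `⟨1,M,1⟩` (relabelling). [folklore] -/
theorem matMulTensor_M11_swap₁₃ (M : ℕ) :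
    TensorRestrictsTo (fun (u : Fin 1 × Fin 1) (v : Fin M × Fin 1) (w : Fin M × Fin 1) => matMulTensor K M 1 1 w v u)
        (matMulTensor K 1 M 1) ∧
      TensorRestrictsTo (matMulTensor K 1 M 1)
        (fun (u : Fin 1 × Fin 1) (v : Fin M × Fin 1) (w : Fin M × Fin 1) => matMulTensor K M 1 1 w v u) := by
  have e1 : (fun (u : Fin 1 × Fin 1) (v : Fin M × Fin 1) (w : Fin M × Fin 1) => matMulTensor K M 1 1 w v u) =
      fun u v w => matMulTensor K 1 M 1 u (v.2, v.1) w := by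
    funext u v w
    simp only [matMulTensor, Subsingleton.elim v.2 u.1, Subsingleton.elim w.2 u.2, and_true, true_and]
    by_cases h : w.1 = v.1
    · rw [if_pos h, if_pos h.symm]
    · rw [if_neg h, if_neg (Ne.symm h)]
  have e2 : matMulTensor K 1 M 1 = fun (u : Fin 1 × Fin 1) (v : Fin 1 × Fin M) (w : Fin M × Fin 1) =>
      (fun (u : Fin 1 × Fin 1) (v : Fin M × Fin 1) (w : Fin M × Fin 1) => matMulTensor K M 1 1 w v u) u (v.2, v.1) w := by
    rw [e1]
  constructor
  · rw [e2]; exact TensorRestrictsTo.comap _ _ _ _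
  · conv_rhs => rw [e1]
    exact TensorRestrictsTo.comap _ _ _ _

/-- `⟨M,1,1⟩` read with the second and third slots exchanged is `⟨1,1,M⟩` (relabelling). [folklore] -/
theorem matMulTensor_M11_swap₂₃ (M : ℕ) :
    TensorRestrictsTo (fun (u : Fin M × Fin 1) (v : Fin 1 × Fin 1) (w : Fin M × Fin 1) => matMulTensor K M 1 1 u w v)
        (matMulTensor K 1 1 M) ∧
      TensorRestrictsTo (matMulTensor K 1 1 M)
        (fun (u : Fin M × Fin 1) (v : Fin 1 × Fin 1) (w : Fin M × Fin 1) => matMulTensor K M 1 1 u w v) := by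
  have e1 : (fun (u : Fin M × Fin 1) (v : Fin 1 × Fin 1) (w : Fin M × Fin 1) => matMulTensor K M 1 1 u w v) =
      fun u v w => matMulTensor K 1 1 M (u.2, u.1) v (w.2, w.1) := by
    funext u v w
    simp only [matMulTensor, Subsingleton.elim w.2 v.1, Subsingleton.elim u.2 v.2, Subsingleton.elim v.1 v.2, and_true, true_and]
  have e2 : matMulTensor K 1 1 M = fun (u : Fin 1 × Fin M) (v : Fin 1 × Fin 1) (w : Fin 1 × Fin M) =>
      (fun (u : Fin M × Fin 1) (v : Fin 1 × Fin 1) (w : Fin M × Fin 1) => matMulTensor K M 1 1 u w v) (u.2, u.1) v (w.2, w.1) := by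
    rw [e1]
  constructor
  · rw [e2]; exact TensorRestrictsTo.comap _ _ _ _
  · conv_rhs => rw [e1]
    exact TensorRestrictsTo.comap _ _ _ _

/-- **Thm. 6.1, `i`-orientation**: if every term has `i_t = 0` and `x₀` is admissible, `𝒯_{τ,L,ε} ≅ ⟨1, M, 1⟩`
(`M = |mmVars|` of the `X ↔ Z` renamed list, i.e. the `Z`-variables whose partner is an admissible
`Y`-variable). [cite: VassilevskaWilliamsXuXuZhou2024, Thm. 6.1 ("Similar results hold when i_t = 0")] -/
theorem vxxz2024_thm61_iso_multi_i (hi : ∀ t, (L t).i = 0) (ε : ℝ)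
    (hx : levelSeq (0 : Fin n → Fin c → Fin (q + 2)) ∈ levelBlocksX τ L ε) :
    TensorRestrictsTo (interfaceTensor K q τ L ε) (matMulTensor K 1 (mmVars q τ (fun t => (L t).swapXZ) ε).card 1) ∧
      TensorRestrictsTo (matMulTensor K 1 (mmVars q τ (fun t => (L t).swapXZ) ε).card 1) (interfaceTensor K q τ L ε) := by
  have hk : ∀ t, ((fun t => (L t).swapXZ) t).k = 0 := fun t => by simpa using hi t
  have hz : levelSeq (0 : Fin n → Fin c → Fin (q + 2)) ∈ levelBlocksZ τ (fun t => (L t).swapXZ) ε := hx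
  obtain ⟨h₁, h₂⟩ := vxxz2024_thm61_iso_multi K q τ (fun t => (L t).swapXZ) hk ε hz
  obtain ⟨r₁, r₂⟩ := matMulTensor_M11_swap₁₃ K (mmVars q τ (fun t => (L t).swapXZ) ε).card
  have e : (fun u v w => interfaceTensor K q τ (fun t => (L t).swapXZ) ε w v u) = interfaceTensor K q τ L ε := by
    funext u v w; exact interfaceTensor_swapXZ K q τ L ε u v w
  have h₁' := h₁.swap₁₃.swap₂₃
  have h₂' := h₂.swap₁₃.swap₂₃
  rw [e] at h₁' h₂'
  exact ⟨h₁'.trans r₁, r₂.trans h₂'⟩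

/-- **Thm. 6.1, `j`-orientation**: if every term has `j_t = 0` and `y₀` is admissible, `𝒯_{τ,L,ε} ≅ ⟨1, 1, M⟩`
(`M = |mmVars|` of the `Y ↔ Z` renamed list). [cite: VassilevskaWilliamsXuXuZhou2024, Thm. 6.1 ("Similar results hold when … j_t = 0")] -/
theorem vxxz2024_thm61_iso_multi_j (hj : ∀ t, (L t).j = 0) (ε : ℝ)
    (hy : levelSeq (0 : Fin n → Fin c → Fin (q + 2)) ∈ levelBlocksY τ L ε) :
    TensorRestrictsTo (interfaceTensor K q τ L ε) (matMulTensor K 1 1 (mmVars q τ (fun t => (L t).swapYZ) ε).card) ∧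
      TensorRestrictsTo (matMulTensor K 1 1 (mmVars q τ (fun t => (L t).swapYZ) ε).card) (interfaceTensor K q τ L ε) := by
  have hk : ∀ t, ((fun t => (L t).swapYZ) t).k = 0 := fun t => by simpa using hj t
  have hz : levelSeq (0 : Fin n → Fin c → Fin (q + 2)) ∈ levelBlocksZ τ (fun t => (L t).swapYZ) ε := hy
  obtain ⟨h₁, h₂⟩ := vxxz2024_thm61_iso_multi K q τ (fun t => (L t).swapYZ) hk ε hz
  obtain ⟨r₁, r₂⟩ := matMulTensor_M11_swap₂₃ K (mmVars q τ (fun t => (L t).swapYZ) ε).card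
  have e : (fun u v w => interfaceTensor K q τ (fun t => (L t).swapYZ) ε u w v) = interfaceTensor K q τ L ε := by
    funext u v w; exact interfaceTensor_swapYZ K q τ L ε u v w
  have h₁' := h₁.swap₂₃
  have h₂' := h₂.swap₂₃
  rw [e] at h₁' h₂'
  exact ⟨h₁'.trans r₁, r₂.trans h₂'⟩

end Orient

/-! ## The three orientations together: a matrix multiplication tensor `⟨M₁, M₂, M₃⟩` -/

section Product

variable (K : Type u) [CommSemiring K] (q : ℕ) {c n₁ n₂ n₃ s₁ s₂ s₃ : ℕ}

/-- Matrix tensors with equal formats. [folklore] -/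
theorem matMulTensor_restrictsTo_of_eq {k m n k' m' n' : ℕ} (hk : k = k') (hm : m = m') (hn : n = n') :
    TensorRestrictsTo (matMulTensor K k m n) (matMulTensor K k' m' n') := by
  subst hk; subst hm; subst hn; exact TensorRestrictsTo.refl _

/-- **Thm. 6.1 for a parameter list of matrix multiplication terms in the three orientations**
(the terms grouped as: `k_t = 0` terms `(τ₁, L₁)`, then `i_t = 0` terms `(τ₂, L₂)`, then `j_t = 0`
terms `(τ₃, L₃)`, with `z₀`, `x₀`, `y₀` admissible in the respective groups): the interface tensor of
the concatenated list (Def. 4.1: the tensor product of the three) restricts to — degenerates to — the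
matrix multiplication tensor `⟨M₁, M₂, M₃⟩` (`⟨M₁,1,1⟩ ⊗ ⟨1,M₂,1⟩ ⊗ ⟨1,1,M₃⟩ ≥ ⟨M₁, M₂, M₃⟩`, Bläser
§5.2) — step 3 (level 1) and the matrix factor of step 2 of the Procedure of Degeneration.
[cite: VassilevskaWilliamsXuXuZhou2024, Thm. 6.1 and §8 (Procedure of Degeneration, steps 2–4)] -/
theorem vxxz2024_thm61_matMul (τ₁ : Fin n₁ → Fin s₁) (L₁ : Fin s₁ → InterfaceTerm c) (τ₂ : Fin n₂ → Fin s₂) (L₂ : Fin s₂ → InterfaceTerm c)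
    (τ₃ : Fin n₃ → Fin s₃) (L₃ : Fin s₃ → InterfaceTerm c) (ε : ℝ)
    (hk : ∀ t, (L₁ t).k = 0) (hi : ∀ t, (L₂ t).i = 0) (hj : ∀ t, (L₃ t).j = 0)
    (hz : levelSeq (0 : Fin n₁ → Fin c → Fin (q + 2)) ∈ levelBlocksZ τ₁ L₁ ε)
    (hx : levelSeq (0 : Fin n₂ → Fin c → Fin (q + 2)) ∈ levelBlocksX τ₂ L₂ ε)
    (hy : levelSeq (0 : Fin n₃ → Fin c → Fin (q + 2)) ∈ levelBlocksY τ₃ L₃ ε) :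
    TensorRestrictsTo (interfaceTensor K q (concatTermMap (concatTermMap τ₁ τ₂) τ₃) (Fin.append (Fin.append L₁ L₂) L₃) ε)
      (matMulTensor K (mmVars q τ₁ L₁ ε).card (mmVars q τ₂ (fun t => (L₂ t).swapXZ) ε).card
        (mmVars q τ₃ (fun t => (L₃ t).swapYZ) ε).card) := by
  set M₁ := (mmVars q τ₁ L₁ ε).card
  set M₂ := (mmVars q τ₂ (fun t => (L₂ t).swapXZ) ε).card
  set M₃ := (mmVars q τ₃ (fun t => (L₃ t).swapYZ) ε).card
  have h₁ := (vxxz2024_thm61_iso_multi K q τ₁ L₁ hk ε hz).1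
  have h₂ := (vxxz2024_thm61_iso_multi_i K q τ₂ L₂ hi ε hx).1
  have h₃ := (vxxz2024_thm61_iso_multi_j K q τ₃ L₃ hj ε hy).1
  refine (tensorRestrictsTo_interfaceTensor_concat_kronecker K q _ τ₃ _ L₃ ε).trans ?_
  refine (TensorRestrictsTo.kronecker (tensorRestrictsTo_interfaceTensor_concat_kronecker K q τ₁ τ₂ L₁ L₂ ε)
    (TensorRestrictsTo.refl _)).trans ?_
  refine (TensorRestrictsTo.kronecker (TensorRestrictsTo.kronecker h₁ h₂) h₃).trans ?_
  refine (TensorRestrictsTo.kronecker (tensorRestrictsTo_kronecker_matMulTensor K M₁ 1 1 1 M₂ 1) (TensorRestrictsTo.refl _)).trans ?_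
  refine (tensorRestrictsTo_kronecker_matMulTensor K (M₁ * 1) (1 * M₂) (1 * 1) 1 1 M₃).trans ?_
  exact matMulTensor_restrictsTo_of_eq K (by ring) (by ring) (by ring)

end Product

end Literature.Computability.AlgebraicComplexity
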